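import Literature.AlgebraicGeometry.AbelianSchemes.PoincarePointRestrictingToUnit
import Literature.AlgebraicGeometry.AbelianSchemes.AbelianSchemeSteinOfNoetherian
import Literature.AlgebraicGeometry.Modules.GrothendieckComplexKernelReprNatural
import Literature.AlgebraicGeometry.Modules.PullbackUnitSectionCoherence
import Literature.AlgebraicGeometry.Modules.CechUnitModuleHZeroScalars
import Literature.AlgebraicGeometry.Modules.ModuleCechPrune
import HarnessLib

/-!
# The Grothendieck complex of the Poincaré bundle on affine test objects: `ker(d⁰ ⊗ B') ≅ B'` over the unit point, and no lifting across a
# test object that leaves the unit point ([MumfordAV1970] §13, proof of the Theorem, pp. 127–129)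

Layer `Literature/AlgebraicGeometry/AbelianSchemes`, namespace `Literature.AlgebraicGeometry.AbelianSchemes` (+ two generic lemmas in
`Literature.AlgebraicGeometry.Modules`).  THEOREMS ONLY (no definition, no named fact, no instance, no notation, no `sorry`).  Cell `hodgecm-mathlib`
(D-0151), junction (c-geom-2b-geom) of the «H1-DIM-ANY-CHAR cut» (B-p04 memo v3 §2) in the language of ★ `Modules/AffineTestObjects` /
★ `Modules/GrothendieckComplexKernelRepr(Natural)`: the base is an affine test object `T` over the field `K` carrying a point `ι_T : T → Â`
(in the application an affine open neighbourhood of `0̂`), the bundle is `𝒫_T := (1 × ι_T)^*𝒫` on `A ×_K T`, and `K• := grothendieckComplex A T 𝓥 𝒫_T`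
is its Grothendieck complex over `Γ(T)` (★ B-p10).  With the standing Poincaré data of ★ `PoincarePointOfTrivialPullback` /
★ `PoincarePointRestrictingToUnit` (`π : A → Â = A/K(L)`, `(1 × π)^*𝒫 ≅ Λ(L)`, `ker π = K(L)` on points):

* §1 (generic, `Modules`) `nonempty_secMod_linearEquiv_of_iso` — `Γ(U, L) ≃ₗ[A] Γ(U, L')` along `L ≅ L'` (★ `SecMod.map`);
  `nonempty_secMod_unitModule_top_linearEquiv_of_bijective` — `Γ(⊤, 𝒪_Y) ≃ₗ[A] A` when the structure map `ρ : A → Γ(Y, 𝒪_Y)` is bijective.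
* §2 **`nonempty_ker_grothendieckComplex_baseChange_linearEquiv_of_comp_eq_one`** — for an affine test object `j : T' → T` OVER THE UNIT POINT
  (`j ≫ ι_T = 1`): `ker(d⁰_{K•} ⊗_{Γ(T)} Γ(T')) ≃ₗ[Γ(T')] Γ(T')` — ★ `kernelReprEquiv` (`= Γ(A × T', (1 × j)^*𝒫_T)`), ★
  `nonempty_pullback_pullback_poincare_iso_unitModule_of_comp_eq_one` (`(1 × j)^*𝒫_T ≅ 𝒪`) and universal Stein-ness of abelian schemes
  (★ `AbelianSchemeOver.baseChange_appTop_bijective`: `Γ(T') → Γ(A × T', 𝒪)` bijective).  This is hypothesis (h1′) of ★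
  `exists_residueField_surjective_exact_lcomp_baseChange_of_ker_tests` (rank one over the residue field).
* §3 **`not_forall_ker_baseChange_lifts_of_comp_ne_one`** — for affine test objects `k : T₀ → T'` with `k` SURJECTIVE, `k ≫ j'` over the unit point but
  `j' ≫ ι_T ≠ 1`: NOT every element of `ker(d⁰ ⊗ Γ(T₀))` lifts to `ker(d⁰ ⊗ Γ(T'))` along `k♯ ⊗ 1` — by ★ `kernelReprEquiv_natural` such a lifting
  makes the pull-back of sections `Γ(A × T', 𝒫_{T'}) → Γ(A × T₀, 𝒪) ` surjective, hence some section of `𝒫_{T'}` becomes a unit over `T₀`, and ★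
  `eq_one_of_forall_surjective_pullback_section_poincare` forces `j' ≫ ι_T = 1`.  This is hypothesis (h2′) (no lifting across the thickenings
  `Spec(R/J)`, `𝔪² ≤ J ≠ 𝔪`).

HC_CM is proved only modulo the 7 printed citations until rung 0 closes; nothing here bears on a summit statement (count-neutral capital).

## References
* [MumfordAV1970] D. Mumford, *Abelian Varieties* (1970), §13, proof of the Theorem (pp. 127–129); §5 Cor. 2 (pp. 50–51).
* [GortzWedhorn2023] U. Görtz, T. Wedhorn, *Algebraic Geometry II* (2023), Cor. 23.135 (p. 355), Cor. 24.63 (p. 404).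
-/

set_option autoImplicit false

universe u

open CategoryTheory CategoryTheory.Limits AlgebraicGeometry MonoidalCategory CartesianMonoidalCategory TensorProduct
open scoped MonObj

noncomputable section

/-! ## §1 Two generic lemmas on sections modules -/

namespace Literature.AlgebraicGeometry.Modules

/-- `Γ(U, L) ≃ₗ[A] Γ(U, L')` (as `A`-modules through `ρ`) along an isomorphism of modules `L ≅ L'` (★ `SecMod.map` both ways).
[cite: GortzWedhorn2023, Def. 21.68 (p. 180)] -/
theorem nonempty_secMod_linearEquiv_of_iso {Y : Scheme.{u}} {A : Type u} [CommRing A] (ρ : A →+* Γ(Y, ⊤)) {L L' : Y.Modules}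
    (φ : L ≅ L') (U : Y.Opens) : Nonempty (SecMod L ρ U ≃ₗ[A] SecMod L' ρ U) := by
  refine ⟨LinearEquiv.ofLinear (SecMod.map ρ φ.hom U) (SecMod.map ρ φ.inv U) ?_ ?_⟩
  · apply LinearMap.ext; intro x; apply SecMod.val_injective (ρ := ρ)
    change (φ.inv ≫ φ.hom).app _ (SecMod.val (ρ := ρ) x) = SecMod.val (ρ := ρ) x
    rw [φ.inv_hom_id]; rfl
  · apply LinearMap.ext; intro x; apply SecMod.val_injective (ρ := ρ)
    change (φ.hom ≫ φ.inv).app _ (SecMod.val (ρ := ρ) x) = SecMod.val (ρ := ρ) x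
    rw [φ.hom_inv_id]; rfl

/-- **`Γ(⊤, 𝒪_Y) ≃ₗ[A] A` when the structure map `ρ : A → Γ(Y, 𝒪_Y)` is bijective** (the `A`-action on `Γ(⊤, 𝒪_Y)` is multiplication by
`ρ(a)`, ★ `SecMod.toRing_smul`, ★ `toSections_top`). [cite: GortzWedhorn2023, Def. 21.68 (p. 180)] -/
theorem nonempty_secMod_unitModule_top_linearEquiv_of_bijective {Y : Scheme.{u}} {A : Type u} [CommRing A] (ρ : A →+* Γ(Y, ⊤))
    (hρ : Function.Bijective ρ) : Nonempty (SecMod (unitModule Y) ρ ⊤ ≃ₗ[A] A) := by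
  let e : A ≃+* Γ(Y, ⊤) := RingEquiv.ofBijective ρ hρ
  have he : ∀ a, e a = ρ a := fun _ => rfl
  refine ⟨{ toFun := fun x => e.symm (SecMod.toRing ρ x)
            invFun := fun a => SecMod.ofRing ρ (ρ a)
            map_add' := fun x y => by rw [SecMod.toRing_add, map_add]
            map_smul' := fun a x => ?_
            left_inv := fun x => ?_
            right_inv := fun a => ?_ }⟩
  · rw [SecMod.toRing_smul, toSections_top, map_mul, RingHom.id_apply, smul_eq_mul, ← he, e.symm_apply_apply]
  · change SecMod.ofRing ρ (ρ (e.symm (SecMod.toRing ρ x))) = x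
    rw [← he, e.apply_symm_apply, SecMod.ofRing_toRing]
  · change e.symm (SecMod.toRing ρ (SecMod.ofRing ρ (ρ a))) = a
    rw [SecMod.toRing_ofRing, ← he, e.symm_apply_apply]

end Literature.AlgebraicGeometry.Modules

namespace Literature.AlgebraicGeometry.AbelianSchemes

namespace AbelianSchemeOver

open Literature.AlgebraicGeometry.Motives Literature.AlgebraicGeometry.Modules

variable {K : Type} [Field K] (A hat : AbelianSchemeOver (Spec (CommRingCat.of K))) (π : A.X ⟶ hat.X) [IsMonHom π]
  [Flat π.left] [Surjective π.left]
  {L : A.left.Modules} (hL : HasRank L 1)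
  (hε : CechPic.pullback A.unitSection (detClass (HasRank.isFiniteLocallyFree' hL)) = 1)
  (hker : ∀ (T : Over (Spec (CommRingCat.of K))) (u : T ⟶ A.X), u ≫ π = 1 ↔ A.MemKOfL L u)
  (P : (A.prodLeft hat).Modules)
  (hsock : Nonempty ((Scheme.Modules.pullback (A.X ◁ π).left).obj P ≅ A.mumfordBundle L)) (hP1 : HasRank P 1)
  -- the affine test base `T → Â` and the Grothendieck complex of `𝒫_T`
  (T : SchemeOver K) [IsAffine T.left] [IsNoetherianRing Γ(T.left, ⊤)] [IsLocallyNoetherian T.left] (gT : T ⟶ hat.X)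
  {κ : Type} [LinearOrder κ] [Fintype κ] (𝓥 : κ → (A.X ⊗ T).left.Opens)
  (hV : ∀ s : Finset κ, s.Nonempty → IsAffineOpen (cechOpen 𝓥 s)) (hcov : ⨆ i, 𝓥 i = ⊤)
  (hPT : HasRank ((Scheme.Modules.pullback (A.X ◁ gT).left).obj P) 1)
  [IsProper A.X.hom] [GeometricallyIntegral A.X.hom] [Flat A.X.hom] [UniversallyOpen A.X.hom]

/-! ## §2 Over the unit point: `ker(d⁰ ⊗ Γ(T')) ≅ Γ(T')` -/

include hL hε hsock in
omit [Flat π.left] [Surjective π.left] in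
/-- **`ker(d⁰_{K•} ⊗_{Γ(T)} Γ(T')) ≃ₗ[Γ(T')] Γ(T')` for an affine test object `j : T' → T` with `j ≫ ι_T = 1`** (`K•` the Grothendieck complex of
`𝒫_T = (1 × ι_T)^*𝒫` on `A × T`): `ker(d⁰ ⊗ Γ(T')) = Γ(A × T', (1 × j)^*𝒫_T)` (★ `kernelReprEquiv`), `(1 × j)^*𝒫_T ≅ 𝒪` (★
`nonempty_pullback_pullback_poincare_iso_unitModule_of_comp_eq_one`) and `Γ(A × T', 𝒪) = Γ(T')` (★ `baseChange_appTop_bijective`).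
[cite: MumfordAV1970, §13, proof of the Theorem (pp. 127–129)] [cite: GortzWedhorn2023, Cor. 23.135 (p. 355), Cor. 24.63 (p. 404)] -/
theorem nonempty_ker_grothendieckComplex_baseChange_linearEquiv_of_comp_eq_one
    {T' : SchemeOver K} [IsAffine T'.left] (j : T' ⟶ T) (hj : j ≫ gT = 1) :
    letI := testAlgebra T j
    Nonempty (LinearMap.ker (((grothendieckComplex A.X T 𝓥 ((Scheme.Modules.pullback (A.X ◁ gT).left).obj P) hV hcov hPT).d 0 1).hom.baseChange
        Γ(T'.left, ⊤)) ≃ₗ[Γ(T'.left, ⊤)] Γ(T'.left, ⊤)) := by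
  letI := testAlgebra T j
  -- `(1 × j)^*𝒫_T ≅ 𝒪` on `A × T'`
  obtain ⟨φ⟩ := A.nonempty_pullback_pullback_poincare_iso_unitModule_of_comp_eq_one hat π hL hε P hsock j gT hj
  -- `Γ(A × T', (1 × j)^*𝒫_T) ≃ ker(d⁰ ⊗ Γ(T'))`
  let θ := kernelReprEquiv A.X T 𝓥 ((Scheme.Modules.pullback (A.X ◁ gT).left).obj P) hV hcov hPT j
  obtain ⟨e₁⟩ := nonempty_secMod_linearEquiv_of_iso (baseToTotal A.X T') φ ⊤
  -- Stein: `Γ(T') → Γ(A × T', 𝒪)` is bijective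
  have hSt : Function.Bijective (baseToTotal A.X T') := by
    have h := A.baseChange_appTop_bijective T'.hom
    exact h
  obtain ⟨e₂⟩ := nonempty_secMod_unitModule_top_linearEquiv_of_bijective (baseToTotal A.X T') hSt
  exact ⟨θ.symm.trans (e₁.trans e₂)⟩

/-! ## §3 Off the unit point: no lifting of `ker(d⁰ ⊗ Γ(T₀))` through a surjective `k : T₀ → T'` -/

set_option maxHeartbeats 800000 in
include hL hε hker hsock hP1 in
/-- **No lifting across a test object leaving the unit point.**  For affine test objects `k : T₀ → T'`, `j' : T' → T` with `k` surjective,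
`(k ≫ j') ≫ ι_T = 1` and `j' ≫ ι_T ≠ 1`, it is NOT the case that every `y ∈ ker(d⁰_{K•} ⊗ Γ(T₀))` is `(k♯ ⊗ 1)(x)` for some
`x ∈ ker(d⁰_{K•} ⊗ Γ(T'))`: otherwise (★ `kernelReprEquiv`, ★ `kernelReprEquiv_natural`) the pull-back of sections
`Γ(A × T', 𝒫_{T'}) → Γ(A × T₀, 𝒫_{T₀}) ≅ Γ(A × T₀, 𝒪)` is onto, so for every trivialisation over `T₀` some section of `𝒫_{T'} = (1 × (j' ≫ ι_T))^*𝒫`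
pulls back to a unit, and ★ `eq_one_of_forall_surjective_pullback_section_poincare` gives `j' ≫ ι_T = 1`.
[cite: MumfordAV1970, §13, proof of the Theorem (pp. 127–129)] [cite: GortzWedhorn2023, Cor. 23.135 (p. 355)] -/
theorem not_forall_ker_baseChange_lifts_of_comp_ne_one
    {T' T₀ : SchemeOver K} [IsAffine T'.left] [IsAffine T₀.left] (j' : T' ⟶ T) (k : T₀ ⟶ T') [Surjective k.left]
    (hk1 : (k ≫ j') ≫ gT = 1) (hne : j' ≫ gT ≠ 1) :
    letI := testAlgebra T j'; letI := testAlgebra T (k ≫ j')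
    ¬ ∀ y : Γ(T₀.left, ⊤) ⊗[Γ(T.left, ⊤)] (grothendieckComplex A.X T 𝓥 ((Scheme.Modules.pullback (A.X ◁ gT).left).obj P) hV hcov hPT).X 0,
        ((grothendieckComplex A.X T 𝓥 ((Scheme.Modules.pullback (A.X ◁ gT).left).obj P) hV hcov hPT).d 0 1).hom.baseChange Γ(T₀.left, ⊤) y = 0 →
        ∃ x : Γ(T'.left, ⊤) ⊗[Γ(T.left, ⊤)] (grothendieckComplex A.X T 𝓥 ((Scheme.Modules.pullback (A.X ◁ gT).left).obj P) hV hcov hPT).X 0,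
          ((grothendieckComplex A.X T 𝓥 ((Scheme.Modules.pullback (A.X ◁ gT).left).obj P) hV hcov hPT).d 0 1).hom.baseChange Γ(T'.left, ⊤) x = 0 ∧
          (testAlgHom T j' (k ≫ j') k rfl).toLinearMap.rTensor
            ((grothendieckComplex A.X T 𝓥 ((Scheme.Modules.pullback (A.X ◁ gT).left).obj P) hV hcov hPT).X 0) x = y := by
  letI := testAlgebra T j'; letI := testAlgebra T (k ≫ j')
  intro H
  apply hne
  have hkg : k ≫ (j' ≫ gT) = 1 := by rw [← Category.assoc]; exact hk1
  refine A.eq_one_of_forall_surjective_pullback_section_poincare hat π hL hε hker P hsock hP1 k (j' ≫ gT) hkg fun ψ => ?_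
  -- comparison of `(1 × j')^*𝒫_T` with `(1 × (j' ≫ ι_T))^*𝒫`, and of the double pull-back with `(1 × (k ≫ j'))^*𝒫_T`
  have hcomp : (A.X ◁ j').left ≫ (A.X ◁ gT).left = (A.X ◁ (j' ≫ gT)).left := by
    rw [← Over.comp_left, ← MonoidalCategory.whiskerLeft_comp]
  let β : testMod A.X T j' ((Scheme.Modules.pullback (A.X ◁ gT).left).obj P) ≅
      (Scheme.Modules.pullback (A.X ◁ (j' ≫ gT)).left).obj P :=
    (Scheme.Modules.pullbackComp (A.X ◁ j').left (A.X ◁ gT).left).app P ≪≫ (Scheme.Modules.pullbackCongr hcomp).app P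
  let gc := testModCompIso A.X T ((Scheme.Modules.pullback (A.X ◁ gT).left).obj P) j' (k ≫ j') k rfl
  let ψ' : testMod A.X T (k ≫ j') ((Scheme.Modules.pullback (A.X ◁ gT).left).obj P) ≅ unitModule (A.X ⊗ T₀).left :=
    gc.symm ≪≫ (Scheme.Modules.pullback (A.X ◁ k).left).mapIso β ≪≫ ψ
  -- the lifting hypothesis makes the pull-back of sections along `k` surjective
  let θ' := kernelReprEquiv A.X T 𝓥 ((Scheme.Modules.pullback (A.X ◁ gT).left).obj P) hV hcov hPT j'
  let θ'' := kernelReprEquiv A.X T 𝓥 ((Scheme.Modules.pullback (A.X ◁ gT).left).obj P) hV hcov hPT (k ≫ j')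
  have hsurj : Function.Surjective (pullSec A.X T ((Scheme.Modules.pullback (A.X ◁ gT).left).obj P) j' (k ≫ j') k rfl) := by
    intro s''
    obtain ⟨x, hx0, hxy⟩ := H (θ'' s'' : _) (θ'' s'').2
    refine ⟨θ'.symm ⟨x, hx0⟩, θ''.injective (Subtype.ext ?_)⟩
    rw [kernelReprEquiv_natural, LinearEquiv.apply_symm_apply]
    exact hxy
  -- hence every global function on `A × T₀` is `ψ(η_k(σ))` for a section `σ` of `(1 × (j' ≫ ι_T))^*𝒫`
  intro u
  obtain ⟨s, hs⟩ := hsurj (SecMod.mk (ψ'.inv.app ⊤ u))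
  refine ⟨β.hom.app ⊤ (SecMod.val s), ?_⟩
  have hval := congrArg SecMod.val hs
  rw [val_pullSecLE, unitSectionLE_le_top] at hval
  change gc.hom.app ⊤ _ = ψ'.inv.app ⊤ u at hval
  -- `ψ(β(gc⁻¹(ψ'⁻¹ u))) = u` by the definition of `ψ'`
  have h := congrArg (fun φ => φ.app ⊤ u) ψ'.inv_hom_id
  have h' : ψ'.hom = gc.inv ≫ (Scheme.Modules.pullback (A.X ◁ k).left).map β.hom ≫ ψ.hom := rfl
  simp only [h', Scheme.Modules.Hom.comp_app, Scheme.Modules.Hom.id_app, ConcreteCategory.comp_apply,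
    ConcreteCategory.id_apply] at h
  have hgi : ∀ z, gc.inv.app ⊤ (gc.hom.app ⊤ z) = z := fun z => by
    have h₀ := congrArg (fun φ => φ.app ⊤ z) gc.hom_inv_id
    simp only [Scheme.Modules.Hom.comp_app, Scheme.Modules.Hom.id_app, ConcreteCategory.comp_apply,
      ConcreteCategory.id_apply] at h₀
    exact h₀
  rw [← hval, hgi] at h
  -- naturality of the unit section in the module: `(1 × k)^*β (η_k x) = η_k (β x)`
  have hnat := pullback_map_app_unitSection (A.X ◁ k).left β.hom ⊤ (SecMod.val s)
  change ((Scheme.Modules.pullback (A.X ◁ k).left).map β.hom).app ⊤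
      (Literature.AlgebraicGeometry.Modules.unitSection (A.X ◁ k).left _ ⊤ (SecMod.val s)) =
    Literature.AlgebraicGeometry.Modules.unitSection (A.X ◁ k).left _ ⊤ (β.hom.app ⊤ (SecMod.val s)) at hnat
  rw [hnat] at h
  exact h

end AbelianSchemeOver

end Literature.AlgebraicGeometry.AbelianSchemes

end
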